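import Mathlib.Analysis.SpecialFunctions.Log.NegMulLog
import Mathlib.Analysis.Convex.Jensen
import Mathlib.Analysis.SpecificLimits.Basic
import Mathlib.MeasureTheory.Measure.Real
import Mathlib.MeasureTheory.Measure.Typeclasses.Probability
import Mathlib.Order.LiminfLimsup
import Mathlib.Topology.Instances.ENNReal.Lemmas
import Literature.MathematicalPhysics.KineticTheory.InfiniteChainDynamics
import Literature.Probability.Entropy.FiniteShannon
import HarnessLib

/-!
# Space-time entropy density of the infinite oscillator chain

Topic `Literature/MathematicalPhysics/KineticTheory`; definition request `defn-SpaceTimeEntropyDensity`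
(route `MacroErgodicRigidity` of `AtomisticToContinuum/FouriersLaw`, crux `EntropicGibbsianity`,
item `stmt-AtomisticToContinuum-6547`: the foreseen split `EntropicSmoothing` / `ZeroEntropyGap` is
stated over `0 < spaceTimeEntropyDensity D ν` / `spaceTimeEntropyDensity D ν = 0`).

## The notion

For an infinite-volume dynamics `D : InfiniteChainDynamics P` of the chain `P` (time-one map
`φ₁ = D.flow 1` on `ChainConfig = ℤ → ℝ × ℝ`) and a probability measure `ν` on `ChainConfig`:

* a finite measurable partition of the single-site phase space `ℝ × ℝ` is encoded by a map
  `ξ : ℝ × ℝ → ι` into a finite type (cells `ξ⁻¹{a}`); its **window partition** on the box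
  `Λ_n = {0, …, n}` is `windowCells ξ n : ChainConfig → (Fin (n+1) → ι)`, `σ ↦ (ξ(σ_i))_{i ≤ n}`,
  i.e. `⋁_{i=0}^{n} τ^{-i}(ξ ∘ eval₀)`;
* `windowTimeEntropy D ν ξ n = h_ν(φ₁, ξ_{Λ_n})`, the Kolmogorov–Sinai entropy of the time-one map
  with respect to the window partition (Walters 1982, Def. 4.9);
* `entropyDensity D ν ξ = limsup_{n → ∞} h_ν(φ₁, ξ_{Λ_n}) / (n + 1)` — time-entropy per site;
* `spaceTimeEntropyDensity D ν = sup_ξ entropyDensity D ν ξ ∈ [0, ∞]`, the supremum over all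
  finite measurable partitions `ξ : ℝ × ℝ → Fin k`, `k ∈ ℕ` (Walters 1982, Def. 4.10 pattern).

This is the ENTROPY PER UNIT TIME AND UNIT VOLUME of the space-time process generated by the
commuting pair (spatial shift `τ`, time-one map `φ₁`) (Gaspard 1998, §9.4.1 eq. (9.86):
`h^{(time,space)} = lim_{T, L → ∞} H(T, L)/(T L^d)`, "replacing the group of time translations by the
group of translations in time and in space"), written, as the request asks, with the time limit
taken first (inside `h_ν(φ₁, ·)`) and a `limsup` in the window size. Rationale recorded by the
requester and by the source: the plain KS entropy `h_ν(φ₁) = sup_n h_ν(φ₁, ξ_{Λ_n})` of an infinite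
system at positive temperature is `+∞` (entropy is transported in from spatial infinity — ideal
gases, Gaspard §9.5.1; for cellular automata `h_μ(F, ξ_{[-n,n]}) ≤ (r_L + r_R) h_μ(σ)` uniformly in
the window), and dividing by the window volume kills the transported part in `d = 1`, so the
density measures randomness PRODUCED locally (for coupled map lattices / PDEs it is the density of
positive Lyapunov exponents, Gaspard (9.87)–(9.88); it vanishes for deterministic cellular
automata, §9.4.2, and for ideal gases, §9.5.1).

## Contents (everything PROVED; no named facts)

* generic, self-contained minimum of entropy theory for finite partitions given as maps:
  `partitionEntropy μ ξ = -∑_a μ(ξ⁻¹{a}) log μ(ξ⁻¹{a})` (Walters Def. 4.6), `itinerary T ξ m`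
  (the join `⋁_{j<m} T^{-j}ξ` as the map `x ↦ (ξ(T^j x))_{j<m}`), `dynamicalEntropy μ T ξ =
  inf_{m ≥ 1} H_μ(⋁_{j<m} T^{-j}ξ)/m` in `ℝ≥0∞` (Walters Def. 4.9 with Thm 4.10: for
  measure-preserving `T` the sequence decreases to its limit, so `inf = lim`);
* API: `partitionEntropy_nonneg`, `partitionEntropy_le_log_card` (Jensen, Walters Cor. 4.2.1),
  `partitionEntropy_comp_le` (coarsening `f ∘ ξ` does not increase entropy, Walters Thm 4.3(iv)),
  `partitionEntropy_comp_of_injective` (relabelling), `dynamicalEntropy_le_partitionEntropy`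
  (Walters Thm 4.12(i)), `dynamicalEntropy_comp_le` (4.12(iii)), `dynamicalEntropy_id` (`h(id) = 0`,
  Walters §4.4 Remark (2));
* chain level: `windowTimeEntropy_le` (`h_ν(φ₁, ξ_{Λ_n}) ≤ (n+1) log |ι|`),
  `entropyDensity_le_log_card` (WELL-DEFINEDNESS: the density of a `k`-cell partition lies in
  `[0, log k]`), `entropyDensity_comp_le` (MONOTONE under refinement of the single-site partition),
  `entropyDensity_comp_of_injective`, `entropyDensity_le_spaceTimeEntropyDensity` (any finite
  measurable codomain), `spaceTimeEntropyDensity_eq_zero_of_flow_one` (no dynamics ⇒ density `0`).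

## What is NOT here, and why

* **The limit in `n` exists** (and equals the infimum) when `ν` is shift-invariant and
  `φ₁`-invariant: `n ↦ h_ν(φ₁, ξ_{Λ_n})` is then subadditive by Walters Thm 4.12(ii) and
  `h_ν(φ₁, τ^{-m}𝒞) = h_ν(φ₁, 𝒞)` (`τ` commutes with `φ₁`). Not needed to state the split; the
  definition uses `limsup` as requested and is hypothesis-free.
* **Equality with the entropy of the `ℤ²`-action** `(τ, φ₁)` w.r.t. `ξ ∘ eval₀` (joint limit of
  `H(rectangle join)/(n m)`, Gaspard (9.86) with partitions in place of `(ε, τ)`) holds for doubly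
  invariant `ν` by the same subadditivity bookkeeping; not formalised.
* **Value `0` for the Gaussian Gibbs states of the harmonic chain** and **positivity for the
  anharmonic pinned chain** are not printed theorems for this object (the former would follow from
  the entropy theory of Gaussian group actions with singular spectral measure; the latter is the
  route's conjecture) — they are left to the route's statements; nothing is asserted here.
* **Affinity in `ν`** (Walters Thm 8.1 pattern) and the conditional / transport versions
  (`h_ν(φ₁ ‖ spatial past)`, Shereshevsky-type bounds) belong with the general Kolmogorov–Sinai file
  requested as `defn-KolmogorovSinaiEntropy` (`Literature/Dynamics/Ergodic`); the generic part of
  this file is the minimal self-contained fragment needed to give the density a body now, stated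
  for partitions-as-maps so that a bridge to that file is a one-line unfolding.

## Design choices

* Partitions are maps into finite types (no quotienting by null sets); `μ.real` of a cell is used,
  so every definition typechecks without measurability; the lemmas assume measurable cells, a
  finite (resp. probability) measure and, where the time-one map enters a preimage, `Measurable
  (D.flow 1)` (which `D.PreservesMeasure ν` provides).
* `dynamicalEntropy`, `entropyDensity`, `spaceTimeEntropyDensity` are `ℝ≥0∞`-valued (`inf`,
  `limsup`, `sup` are then junk-free); `partitionEntropy` is a real number.
* The supremum ranges over `ξ : ℝ × ℝ → Fin k`, `k : ℕ`, `Measurable ξ`; any finite measurable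
  codomain is covered by relabelling (`entropyDensity_le_spaceTimeEntropyDensity`).
-/

noncomputable section

open MeasureTheory Filter Set
open scoped ENNReal Topology

namespace Literature.MathematicalPhysics.KineticTheory.HeatConduction

/-! ### Entropy of a finite partition given as a map, and dynamical entropy -/

section Generic

variable {α ι κ : Type*}

/-- The **Shannon entropy of the finite partition** `{ξ⁻¹{a}}_{a ∈ ι}` of `(α, μ)` cut out by a map
`ξ` into a finite type: `H_μ(ξ) = -∑_a μ(ξ⁻¹{a}) log μ(ξ⁻¹{a})` (natural logarithm, `0 log 0 = 0`,
written with `Real.negMulLog` and the real-valued measure `μ.real`). [cite: Walters1982, §4.2 Def. 4.6] -/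
def partitionEntropy [MeasurableSpace α] (μ : Measure α) [Fintype ι] (ξ : α → ι) : ℝ :=
  ∑ a, (μ.real (ξ ⁻¹' {a})).negMulLog

/-- The **itinerary map** of length `m`: `x ↦ (ξ x, ξ (T x), …, ξ (T^{m-1} x))`; its fibres are the
cells `⋂_{j<m} T^{-j} A_{w_j}` of the join `⋁_{j=0}^{m-1} T^{-j} ξ`. [cite: Walters1982, §4.4 (before Def. 4.9)] -/
def itinerary (T : α → α) (ξ : α → ι) (m : ℕ) : α → (Fin m → ι) :=
  fun x j => ξ (T^[(j : ℕ)] x)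

/-- The **entropy of `T` with respect to the finite partition `ξ`**,
`h_μ(T, ξ) = inf_{m ≥ 1} (1/m) H_μ(⋁_{j=0}^{m-1} T^{-j} ξ)`, valued in `[0, ∞]`. Walters defines
`h(T, ξ)` as the limit of this sequence and proves (Thm 4.10) that for measure-preserving `T` the
sequence DECREASES to it, so the infimum used here is that limit; for non-invariant `μ` the
infimum is a definite (junk-free) extension. [cite: Walters1982, §4.4 Def. 4.9 and Thm 4.10] -/
def dynamicalEntropy [MeasurableSpace α] (μ : Measure α) [Fintype ι] (T : α → α) (ξ : α → ι) :
    ℝ≥0∞ :=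
  ⨅ m : ℕ, ENNReal.ofReal (partitionEntropy μ (itinerary T ξ (m + 1)) / ((m : ℝ) + 1))

/-- The itinerary of a coarsened partition is the coarsened itinerary. [folklore] -/
theorem itinerary_comp (T : α → α) (ξ : α → ι) (f : ι → κ) (m : ℕ) :
    itinerary T (f ∘ ξ) m = (fun w => f ∘ w) ∘ itinerary T ξ m := rfl

variable [MeasurableSpace α]

/-- Unfolding `partitionEntropy`. [folklore] -/
theorem partitionEntropy_def (μ : Measure α) [Fintype ι] (ξ : α → ι) :
    partitionEntropy μ ξ = ∑ a, (μ.real (ξ ⁻¹' {a})).negMulLog := rfl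

/-- Unfolding `dynamicalEntropy`. [folklore] -/
theorem dynamicalEntropy_def (μ : Measure α) [Fintype ι] (T : α → α) (ξ : α → ι) :
    dynamicalEntropy μ T ξ =
      ⨅ m : ℕ, ENNReal.ofReal (partitionEntropy μ (itinerary T ξ (m + 1)) / ((m : ℝ) + 1)) := rfl

/-- `H_μ(ξ) ≥ 0` for a probability measure (Walters §4.2 Remark (3)). [cite: Walters1982, §4.2 Remark (3)] -/
theorem partitionEntropy_nonneg (μ : Measure α) [IsProbabilityMeasure μ] [Fintype ι] (ξ : α → ι) :
    0 ≤ partitionEntropy μ ξ :=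
  Finset.sum_nonneg fun _ _ => Real.negMulLog_nonneg measureReal_nonneg measureReal_le_one

/-- The cells of a partition-as-map exhaust the probability: `∑_a μ(ξ⁻¹{a}) = 1`. [folklore] -/
theorem sum_measureReal_fiber_eq_one (μ : Measure α) [IsProbabilityMeasure μ] [Fintype ι]
    {ξ : α → ι} (hξ : ∀ b, MeasurableSet (ξ ⁻¹' {b})) : ∑ a, μ.real (ξ ⁻¹' {a}) = 1 := by
  rw [sum_measureReal_preimage_singleton Finset.univ (fun b _ => hξ b)]
  simp

/-- `-x log x` is subadditive on finite sums of nonnegative reals. [folklore] -/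
theorem negMulLog_sum_le {s : Finset κ} {x : κ → ℝ} (hx : ∀ b ∈ s, 0 ≤ x b) :
    (∑ b ∈ s, x b).negMulLog ≤ ∑ b ∈ s, (x b).negMulLog :=
  Finset.le_sum_of_subadditive_on_pred Real.negMulLog (0 ≤ ·) (by simp)
    (fun _ _ ha hb => Literature.Probability.Entropy.FiniteShannon.negMulLog_add_le ha hb)
    (fun _ _ ha hb => add_nonneg ha hb) x hx

/-- **`H(ξ) ≤ log k`** for a partition into (at most) `k = |ι|` cells of a probability space
(Jensen for the concave `-x log x`). [cite: Walters1982, §4.2 Cor. 4.2.1] -/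
theorem partitionEntropy_le_log_card (μ : Measure α) [IsProbabilityMeasure μ] [Fintype ι]
    [Nonempty ι] {ξ : α → ι} (hξ : ∀ b, MeasurableSet (ξ ⁻¹' {b})) :
    partitionEntropy μ ξ ≤ Real.log (Fintype.card ι) := by
  classical
  have hcard : 0 < (Fintype.card ι : ℝ) := by exact_mod_cast Fintype.card_pos
  have hsum : ∑ a, μ.real (ξ ⁻¹' {a}) = 1 := sum_measureReal_fiber_eq_one μ hξ
  -- Jensen: `∑ (1/N) φ(p a) ≤ φ(∑ (1/N) p a) = φ(1/N)`, `φ = negMulLog`.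
  have hJ := Real.concaveOn_negMulLog.le_map_sum (t := Finset.univ)
    (w := fun _ : ι => (Fintype.card ι : ℝ)⁻¹) (p := fun a => μ.real (ξ ⁻¹' {a}))
    (fun _ _ => by positivity) (by simp [Finset.card_univ, hcard.ne'])
    (fun i _ => Set.mem_Ici.2 measureReal_nonneg)
  simp only [smul_eq_mul, ← Finset.mul_sum, hsum, mul_one] at hJ
  rw [Real.negMulLog, Real.log_inv, mul_neg, neg_mul, neg_neg] at hJ
  exact le_of_mul_le_mul_left hJ (inv_pos.2 hcard)

/-- **Coarsening does not increase entropy**: the partition `f ∘ ξ` (cells = unions of cells of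
`ξ`) has `H(f ∘ ξ) ≤ H(ξ)` (`𝒜 ⊆ 𝒞 ⇒ H(𝒜) ≤ H(𝒞)`). [cite: Walters1982, §4.3 Thm 4.3(iv)] -/
theorem partitionEntropy_comp_le (μ : Measure α) [IsFiniteMeasure μ] [Fintype ι] [Fintype κ]
    {ξ : α → ι} (hξ : ∀ b, MeasurableSet (ξ ⁻¹' {b})) (f : ι → κ) :
    partitionEntropy μ (f ∘ ξ) ≤ partitionEntropy μ ξ := by
  classical
  unfold partitionEntropy
  have hfib : ∀ a : κ,
      (f ∘ ξ) ⁻¹' {a} = ⋃ b ∈ Finset.univ.filter (fun b => f b = a), ξ ⁻¹' {b} := by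
    intro a
    ext x
    simp only [mem_preimage, Function.comp_apply, mem_singleton_iff, Finset.mem_filter,
      Finset.mem_univ, true_and, mem_iUnion, exists_prop, exists_eq_right']
  have hreal : ∀ a : κ, μ.real ((f ∘ ξ) ⁻¹' {a}) =
      ∑ b ∈ Finset.univ.filter (fun b => f b = a), μ.real (ξ ⁻¹' {b}) := by
    intro a
    rw [hfib]
    exact measureReal_biUnion_finset
      (fun b _ b' _ hbb' => (Set.disjoint_singleton.2 hbb').preimage ξ) (fun b _ => hξ b)
  calc ∑ a, (μ.real ((f ∘ ξ) ⁻¹' {a})).negMulLog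
      = ∑ a, (∑ b ∈ Finset.univ.filter (fun b => f b = a), μ.real (ξ ⁻¹' {b})).negMulLog := by
        simp_rw [hreal]
    _ ≤ ∑ a, ∑ b ∈ Finset.univ.filter (fun b => f b = a), (μ.real (ξ ⁻¹' {b})).negMulLog :=
        Finset.sum_le_sum fun a _ => negMulLog_sum_le fun b _ => measureReal_nonneg
    _ = ∑ b, (μ.real (ξ ⁻¹' {b})).negMulLog := Finset.sum_fiberwise Finset.univ f _

/-- **Relabelling the cells injectively does not change the entropy.** [folklore] -/
theorem partitionEntropy_comp_of_injective (μ : Measure α) [Fintype ι] [Fintype κ] {e : ι → κ}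
    (he : Function.Injective e) (ξ : α → ι) :
    partitionEntropy μ (e ∘ ξ) = partitionEntropy μ ξ := by
  classical
  unfold partitionEntropy
  symm
  refine Fintype.sum_of_injective e he _ _ (fun a ha => ?_) (fun b => ?_)
  · have : (e ∘ ξ) ⁻¹' {a} = ∅ := by
      ext x
      simp only [mem_preimage, Function.comp_apply, mem_singleton_iff, mem_empty_iff_false,
        iff_false]
      exact fun h => ha ⟨ξ x, h⟩
    simp [this]
  · congr 2
    ext x
    simp [he.eq_iff]

/-- The fibres of an itinerary map of a measurable `T` over a partition with measurable cells are
measurable (they are the finite intersections `⋂_{j<m} T^{-j} A_{w_j}`). [folklore] -/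
theorem measurableSet_itinerary_fiber {T : α → α} (hT : Measurable T) {ξ : α → ι}
    (hξ : ∀ b, MeasurableSet (ξ ⁻¹' {b})) (m : ℕ) (w : Fin m → ι) :
    MeasurableSet ((itinerary T ξ m) ⁻¹' {w}) := by
  have : (itinerary T ξ m) ⁻¹' {w} = ⋂ j : Fin m, (T^[(j : ℕ)]) ⁻¹' (ξ ⁻¹' {w j}) := by
    ext x
    simp [itinerary, funext_iff]
  rw [this]
  exact MeasurableSet.iInter fun j => (hT.iterate _) (hξ (w j))

/-- `h(T, ξ) ≤ H(⋁_{j ≤ m} T^{-j}ξ)/(m+1)` for every `m` (the infimum is below each term).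
[cite: Walters1982, §4.4 Thm 4.10] -/
theorem dynamicalEntropy_le_term (μ : Measure α) [Fintype ι] (T : α → α) (ξ : α → ι) (m : ℕ) :
    dynamicalEntropy μ T ξ ≤
      ENNReal.ofReal (partitionEntropy μ (itinerary T ξ (m + 1)) / ((m : ℝ) + 1)) :=
  iInf_le _ m

/-- The itinerary of length `1` is the partition itself (relabelled): `H(⋁_{j<1} T^{-j}ξ) = H(ξ)`.
[folklore] -/
theorem partitionEntropy_itinerary_one (μ : Measure α) [Fintype ι] (T : α → α) (ξ : α → ι) :
    partitionEntropy μ (itinerary T ξ 1) = partitionEntropy μ ξ := by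
  have h : itinerary T ξ 1 = (fun (b : ι) (_ : Fin 1) => b) ∘ ξ := by
    funext x j
    simp [itinerary, Fin.fin_one_eq_zero j]
  rw [h]
  exact partitionEntropy_comp_of_injective μ (fun b b' hbb' => by simpa using congr_fun hbb' 0) ξ

/-- **`h(T, ξ) ≤ H(ξ)`.** [cite: Walters1982, §4.5 Thm 4.12(i)] -/
theorem dynamicalEntropy_le_partitionEntropy (μ : Measure α) [Fintype ι] (T : α → α) (ξ : α → ι) :
    dynamicalEntropy μ T ξ ≤ ENNReal.ofReal (partitionEntropy μ ξ) := by
  simpa [partitionEntropy_itinerary_one] using dynamicalEntropy_le_term μ T ξ 0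

/-- **`h(T, ·)` is monotone under refinement**: `h(T, f ∘ ξ) ≤ h(T, ξ)`
(`𝒜 ⊆ 𝒞 ⇒ h(T, 𝒜) ≤ h(T, 𝒞)`), for measurable `T` and measurable cells.
[cite: Walters1982, §4.5 Thm 4.12(iii)] -/
theorem dynamicalEntropy_comp_le (μ : Measure α) [IsFiniteMeasure μ] [Fintype ι] [Fintype κ]
    {T : α → α} (hT : Measurable T) {ξ : α → ι} (hξ : ∀ b, MeasurableSet (ξ ⁻¹' {b}))
    (f : ι → κ) : dynamicalEntropy μ T (f ∘ ξ) ≤ dynamicalEntropy μ T ξ := by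
  refine iInf_mono fun m => ENNReal.ofReal_le_ofReal (div_le_div_of_nonneg_right ?_ (by positivity))
  rw [itinerary_comp]
  exact partitionEntropy_comp_le μ (measurableSet_itinerary_fiber hT hξ (m + 1)) _

/-- Relabelling the cells injectively does not change `h(T, ξ)`. [folklore] -/
theorem dynamicalEntropy_comp_of_injective (μ : Measure α) [Fintype ι] [Fintype κ] (T : α → α)
    {e : ι → κ} (he : Function.Injective e) (ξ : α → ι) :
    dynamicalEntropy μ T (e ∘ ξ) = dynamicalEntropy μ T ξ := by
  unfold dynamicalEntropy
  congr 1
  funext m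
  rw [itinerary_comp, partitionEntropy_comp_of_injective μ (fun w w' h => ?_)]
  funext j
  exact he (congr_fun h j)

/-- **No dynamics, no entropy: `h(id, ξ) = 0`** for every finite partition (the joins do not grow,
so `H(⋁_{j<m} ξ)/m = H(ξ)/m → 0`). [cite: Walters1982, §4.4 Remark (2)] -/
theorem dynamicalEntropy_id (μ : Measure α) [Fintype ι] (ξ : α → ι) :
    dynamicalEntropy μ id ξ = 0 := by
  have hH : ∀ m : ℕ, partitionEntropy μ (itinerary id ξ (m + 1)) = partitionEntropy μ ξ := by
    intro m
    have h : itinerary id ξ (m + 1) = (fun (b : ι) (_ : Fin (m + 1)) => b) ∘ ξ := by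
      funext x j
      simp [itinerary]
    rw [h]
    exact partitionEntropy_comp_of_injective μ (fun b b' hbb' => by simpa using congr_fun hbb' 0) ξ
  refine le_antisymm ?_ (zero_le)
  have h1 : Tendsto (fun m : ℕ => partitionEntropy μ ξ / ((m : ℝ) + 1)) atTop (𝓝 0) := by
    have := (tendsto_const_div_atTop_nhds_zero_nat (partitionEntropy μ ξ)).comp
      (tendsto_add_atTop_nat 1)
    refine this.congr fun m => ?_
    simp [Nat.cast_add_one]
  have h2 : Tendsto (fun m : ℕ => ENNReal.ofReal (partitionEntropy μ ξ / ((m : ℝ) + 1))) atTop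
      (𝓝 0) := by
    simpa using ENNReal.tendsto_ofReal h1
  refine ge_of_tendsto' h2 fun m => ?_
  calc dynamicalEntropy μ id ξ
      ≤ ENNReal.ofReal (partitionEntropy μ (itinerary id ξ (m + 1)) / ((m : ℝ) + 1)) :=
        dynamicalEntropy_le_term μ id ξ m
    _ = ENNReal.ofReal (partitionEntropy μ ξ / ((m : ℝ) + 1)) := by rw [hH m]

end Generic

/-! ### Window partitions of the chain and the space-time entropy density -/

variable {ι κ : Type*}

/-- The **window partition** of `ChainConfig` on the box `Λ_n = {0, …, n}` induced by a single-site
partition `ξ` of `ℝ × ℝ`: `σ ↦ (ξ(σ_0), …, ξ(σ_n))`, i.e. the product partition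
`⋁_{i=0}^{n} τ^{-i}(ξ ∘ eval₀)` whose cells are the cylinders `{σ : σ_i ∈ A_{w_i}, 0 ≤ i ≤ n}`.
[folklore] -/
def windowCells (ξ : ℝ × ℝ → ι) (n : ℕ) : ChainConfig → (Fin (n + 1) → ι) :=
  fun σ i => ξ (σ ((i : ℕ) : ℤ))

/-- Unfolding `windowCells`. [folklore] -/
theorem windowCells_apply (ξ : ℝ × ℝ → ι) (n : ℕ) (σ : ChainConfig) (i : Fin (n + 1)) :
    windowCells ξ n σ i = ξ (σ ((i : ℕ) : ℤ)) := rfl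

/-- The window partition of a coarsened single-site partition is the coarsened window partition.
[folklore] -/
theorem windowCells_comp (ξ : ℝ × ℝ → ι) (f : ι → κ) (n : ℕ) :
    windowCells (f ∘ ξ) n = (fun w => f ∘ w) ∘ windowCells ξ n := rfl

/-- The cells of a window partition over measurable single-site cells are measurable cylinders.
[folklore] -/
theorem measurableSet_windowCells_fiber {ξ : ℝ × ℝ → ι} (hξ : ∀ b, MeasurableSet (ξ ⁻¹' {b}))
    (n : ℕ) (w : Fin (n + 1) → ι) : MeasurableSet ((windowCells ξ n) ⁻¹' {w}) := by
  have : (windowCells ξ n) ⁻¹' {w} =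
      ⋂ i : Fin (n + 1), (fun σ : ChainConfig => σ ((i : ℕ) : ℤ)) ⁻¹' (ξ ⁻¹' {w i}) := by
    ext σ
    simp [windowCells, funext_iff]
  rw [this]
  exact MeasurableSet.iInter fun i => (measurable_pi_apply _) (hξ (w i))

namespace InfiniteChainDynamics

variable {P : OscillatorChain} (D : InfiniteChainDynamics P)

/-- `h(ν, ξ, n) = h_ν(φ₁, ξ_{Λ_n})`: the Kolmogorov–Sinai entropy of the TIME-ONE MAP `φ₁ = D.flow 1`
of the infinite chain with respect to the window partition on `Λ_n = {0, …, n}` (the time-entropy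
seen through a window of `n + 1` sites). [cite: Walters1982, §4.4 Def. 4.9] -/
def windowTimeEntropy [Fintype ι] (ν : Measure ChainConfig) (ξ : ℝ × ℝ → ι) (n : ℕ) : ℝ≥0∞ :=
  dynamicalEntropy ν (D.flow 1) (windowCells ξ n)

/-- The **time-entropy per site** of the single-site partition `ξ`:
`limsup_{n → ∞} h_ν(φ₁, ξ_{Λ_n}) / (n + 1)` — entropy per unit time and unit volume of the
space-time process `(τ, φ₁)` read through `ξ` (Gaspard 1998, eq. (9.86), with the time limit taken
first and the spatial resolution fixed by `ξ`). [cite: Gaspard1998, §9.4.1 eq. (9.86)] -/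
def entropyDensity [Fintype ι] (ν : Measure ChainConfig) (ξ : ℝ × ℝ → ι) : ℝ≥0∞ :=
  limsup (fun n : ℕ => D.windowTimeEntropy ν ξ n / ((n : ℝ≥0∞) + 1)) atTop

/-- The **space-time entropy density** (entropy per unit time and unit volume, "locally produced"
time-entropy) of the infinite chain dynamics `D` in the state `ν`:
`sup_ξ limsup_n h_ν(φ₁, ξ_{Λ_n})/(n+1) ∈ [0, ∞]`, the supremum over all finite measurable
partitions `ξ : ℝ × ℝ → Fin k` of the single-site phase space (Gaspard 1998, §9.4.1 eq. (9.86);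
supremum over finite partitions as in Walters Def. 4.10). Intended for `ν` shift-invariant with
`D.PreservesMeasure ν`. [cite: Gaspard1998, §9.4.1 eq. (9.86)] -/
def spaceTimeEntropyDensity (ν : Measure ChainConfig) : ℝ≥0∞ :=
  ⨆ (k : ℕ) (ξ : ℝ × ℝ → Fin k) (_ : Measurable ξ), D.entropyDensity ν ξ

/-! ### API -/

/-- Unfolding `windowTimeEntropy`. [folklore] -/
theorem windowTimeEntropy_def [Fintype ι] (ν : Measure ChainConfig) (ξ : ℝ × ℝ → ι) (n : ℕ) :
    D.windowTimeEntropy ν ξ n = dynamicalEntropy ν (D.flow 1) (windowCells ξ n) := rfl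

/-- Unfolding `entropyDensity`. [folklore] -/
theorem entropyDensity_def [Fintype ι] (ν : Measure ChainConfig) (ξ : ℝ × ℝ → ι) :
    D.entropyDensity ν ξ =
      limsup (fun n : ℕ => D.windowTimeEntropy ν ξ n / ((n : ℝ≥0∞) + 1)) atTop := rfl

/-- Unfolding `spaceTimeEntropyDensity`. [folklore] -/
theorem spaceTimeEntropyDensity_def (ν : Measure ChainConfig) :
    D.spaceTimeEntropyDensity ν =
      ⨆ (k : ℕ) (ξ : ℝ × ℝ → Fin k) (_ : Measurable ξ), D.entropyDensity ν ξ := rfl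

/-- **`h_ν(φ₁, ξ_{Λ_n}) ≤ (n + 1) log |ι|`**: the window partition has at most `|ι|^{n+1}` cells.
[cite: Walters1982, §4.5 Thm 4.12(i) and §4.2 Cor. 4.2.1] -/
theorem windowTimeEntropy_le [Fintype ι] (ν : Measure ChainConfig) [IsProbabilityMeasure ν]
    {ξ : ℝ × ℝ → ι} (hξ : ∀ b, MeasurableSet (ξ ⁻¹' {b})) (n : ℕ) :
    D.windowTimeEntropy ν ξ n ≤ ENNReal.ofReal ((n + 1) * Real.log (Fintype.card ι)) := by
  classical
  haveI : Nonempty ι := ⟨ξ (0, 0)⟩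
  calc D.windowTimeEntropy ν ξ n
      ≤ ENNReal.ofReal (partitionEntropy ν (windowCells ξ n)) :=
        dynamicalEntropy_le_partitionEntropy ν _ _
    _ ≤ ENNReal.ofReal (Real.log (Fintype.card (Fin (n + 1) → ι))) :=
        ENNReal.ofReal_le_ofReal (partitionEntropy_le_log_card ν (measurableSet_windowCells_fiber hξ n))
    _ = ENNReal.ofReal ((n + 1) * Real.log (Fintype.card ι)) := by
        rw [Fintype.card_fun, Fintype.card_fin, Nat.cast_pow, Real.log_pow]
        push_cast
        ring_nf

/-- **Well-definedness / a priori bound**: the entropy density of a partition into `k = |ι|` cells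
lies in `[0, log k]`; in particular it is finite for every fixed finite partition.
[cite: Gaspard1998, §9.4.1 (H grows at most like `T L^d`)] -/
theorem entropyDensity_le_log_card [Fintype ι] (ν : Measure ChainConfig) [IsProbabilityMeasure ν]
    {ξ : ℝ × ℝ → ι} (hξ : ∀ b, MeasurableSet (ξ ⁻¹' {b})) :
    D.entropyDensity ν ξ ≤ ENNReal.ofReal (Real.log (Fintype.card ι)) := by
  refine limsup_le_of_le (h := Eventually.of_forall fun n => ?_)
  refine ENNReal.div_le_of_le_mul' ?_
  calc D.windowTimeEntropy ν ξ n
      ≤ ENNReal.ofReal ((n + 1) * Real.log (Fintype.card ι)) := D.windowTimeEntropy_le ν hξ n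
    _ = ((n : ℝ≥0∞) + 1) * ENNReal.ofReal (Real.log (Fintype.card ι)) := by
        rw [ENNReal.ofReal_mul (by positivity), ENNReal.ofReal_add (by positivity) zero_le_one,
          ENNReal.ofReal_natCast, ENNReal.ofReal_one]

/-- The entropy density of a fixed finite partition is finite. [folklore] -/
theorem entropyDensity_lt_top [Fintype ι] (ν : Measure ChainConfig) [IsProbabilityMeasure ν]
    {ξ : ℝ × ℝ → ι} (hξ : ∀ b, MeasurableSet (ξ ⁻¹' {b})) : D.entropyDensity ν ξ < ∞ :=
  (D.entropyDensity_le_log_card ν hξ).trans_lt ENNReal.ofReal_lt_top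

/-- Coarsening the single-site partition does not increase the window time-entropy.
[cite: Walters1982, §4.5 Thm 4.12(iii)] -/
theorem windowTimeEntropy_comp_le [Fintype ι] [Fintype κ] (ν : Measure ChainConfig)
    [IsFiniteMeasure ν] (hφ : Measurable (D.flow 1)) {ξ : ℝ × ℝ → ι}
    (hξ : ∀ b, MeasurableSet (ξ ⁻¹' {b})) (f : ι → κ) (n : ℕ) :
    D.windowTimeEntropy ν (f ∘ ξ) n ≤ D.windowTimeEntropy ν ξ n := by
  rw [windowTimeEntropy, windowCells_comp]
  exact dynamicalEntropy_comp_le ν hφ (measurableSet_windowCells_fiber hξ n) _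

/-- **Monotonicity in the partition**: a coarser single-site partition `f ∘ ξ` has a smaller
entropy density, `entropyDensity (f ∘ ξ) ≤ entropyDensity ξ` (for measurable time-one map and
measurable cells). [cite: Walters1982, §4.5 Thm 4.12(iii)] -/
theorem entropyDensity_comp_le [Fintype ι] [Fintype κ] (ν : Measure ChainConfig)
    [IsFiniteMeasure ν] (hφ : Measurable (D.flow 1)) {ξ : ℝ × ℝ → ι}
    (hξ : ∀ b, MeasurableSet (ξ ⁻¹' {b})) (f : ι → κ) :
    D.entropyDensity ν (f ∘ ξ) ≤ D.entropyDensity ν ξ :=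
  limsup_le_limsup <| Eventually.of_forall fun n =>
    ENNReal.div_le_div_right (D.windowTimeEntropy_comp_le ν hφ hξ f n) _

/-- Relabelling the cells injectively does not change the entropy density. [folklore] -/
theorem entropyDensity_comp_of_injective [Fintype ι] [Fintype κ] (ν : Measure ChainConfig)
    {e : ι → κ} (he : Function.Injective e) (ξ : ℝ × ℝ → ι) :
    D.entropyDensity ν (e ∘ ξ) = D.entropyDensity ν ξ := by
  unfold entropyDensity windowTimeEntropy
  congr 1
  funext n
  rw [windowCells_comp, dynamicalEntropy_comp_of_injective ν _ (fun w w' h => ?_)]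
  funext i
  exact he (congr_fun h i)

/-- Under `D.PreservesMeasure ν` the time-one map is measurable (so the monotonicity lemmas
apply). [folklore] -/
theorem PreservesMeasure.measurable_flow {D : InfiniteChainDynamics P} {ν : Measure ChainConfig}
    (h : D.PreservesMeasure ν) (t : ℝ) : Measurable (D.flow t) :=
  (h.2 t).measurable

/-- Every finite measurable partition `ξ : ℝ × ℝ → Fin k` is below the supremum. [folklore] -/
theorem entropyDensity_le_spaceTimeEntropyDensity_fin (ν : Measure ChainConfig) {k : ℕ}
    {ξ : ℝ × ℝ → Fin k} (hξ : Measurable ξ) :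
    D.entropyDensity ν ξ ≤ D.spaceTimeEntropyDensity ν :=
  le_iSup_of_le k <| le_iSup_of_le ξ <| le_iSup_of_le hξ le_rfl

/-- Every finite measurable partition with values in ANY finite type (with measurable points) is
below the supremum: relabel through `Fintype.equivFin`. [folklore] -/
theorem entropyDensity_le_spaceTimeEntropyDensity [Fintype ι] [MeasurableSpace ι]
    [MeasurableSingletonClass ι] (ν : Measure ChainConfig) {ξ : ℝ × ℝ → ι} (hξ : Measurable ξ) :
    D.entropyDensity ν ξ ≤ D.spaceTimeEntropyDensity ν := by
  classical
  set e := Fintype.equivFin ι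
  have hmeas : Measurable (e ∘ ξ) :=
    measurable_to_countable' fun j => by
      have : (e ∘ ξ) ⁻¹' {j} = ξ ⁻¹' {e.symm j} := by
        ext x
        simp [Equiv.apply_eq_iff_eq_symm_apply]
      rw [this]
      exact hξ (measurableSet_singleton _)
  rw [← D.entropyDensity_comp_of_injective ν e.injective ξ]
  exact D.entropyDensity_le_spaceTimeEntropyDensity_fin ν hmeas

/-- The density is bounded by `c` as soon as every finite measurable partition has density `≤ c`.
[folklore] -/
theorem spaceTimeEntropyDensity_le_iff (ν : Measure ChainConfig) (c : ℝ≥0∞) :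
    D.spaceTimeEntropyDensity ν ≤ c ↔
      ∀ (k : ℕ) (ξ : ℝ × ℝ → Fin k), Measurable ξ → D.entropyDensity ν ξ ≤ c := by
  simp only [spaceTimeEntropyDensity, iSup_le_iff]

/-- **No dynamics, no entropy density**: if the time-one map is the identity (e.g. the trivial
dynamics with empty carrier), every window time-entropy vanishes and the density is `0` — the
definition is not junk-`∞`. [cite: Walters1982, §4.4 Remark (2)] -/
theorem spaceTimeEntropyDensity_eq_zero_of_flow_one (ν : Measure ChainConfig)
    (h : D.flow 1 = id) : D.spaceTimeEntropyDensity ν = 0 := by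
  refine le_antisymm ((D.spaceTimeEntropyDensity_le_iff ν 0).2 fun k ξ _ => ?_) (zero_le)
  refine limsup_le_of_le (h := Eventually.of_forall fun n => ?_)
  rw [windowTimeEntropy, h, dynamicalEntropy_id]
  simp

end InfiniteChainDynamics

end Literature.MathematicalPhysics.KineticTheory.HeatConduction

end
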